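import Literature.MathematicalPhysics.QuantumFieldTheory.Balaban1983to89.B9LocalLemma24TwoLevelAtLettersY
import Literature.MathematicalPhysics.QuantumFieldTheory.Balaban1983to89.B6TranslateTorusV1

/-!
# `Balaban1983to89.B6SectALemma24TwoLevelV1SitesChart` — T. Bałaban, *Propagators and renormalization transformations for lattice gauge theories. II*,
# Commun. Math. Phys. **96** (1984) 223–250 [Balaban1984PropagatorsII], Lemma 2.4 (2.128) p. 245 for the two-level cube (2.89) p. 239, read THROUGH A TORUS
# CHART (p. 238 «we take the cube □̃³ and identify it with a torus T_□»; (2.1)–(2.4) p. 224 on `T_η`): **THE TWO-SCALE LEMMA-2.4 LETTER FOR CUBES WRAPPING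
# AROUND THE SEAM OF THE PERIOD BOX** — the label margins of `B6SectALemma24TwoLevelV1Sites.lemma24_letter_twoLevel_sites` demanded in a TRANSLATED frame,
# every other hypothesis and the conclusion in the original frame; and its def-Y reading (the chart twin of `B9LocalLemma24TwoLevelAtLettersY.local_lemma24_real_twoLevel`)

statement-level skeleton of published theorems with citation tags; proofs where landed; nothing here is a claim about the Yang–Mills mass gap

PDF held: `paper:balaban1984-cmp96-propagators-rt-ii` (journal page = PDF page + 222), pp. 224, 238–239, 244–245.

CITATION HEADER (lean-in-tree rule).  Cell `pub-ymgap` (Track A, HUMAN RULING D-0062), node N06 [Balaban1985BackgroundPropagators] row 17 (Thm 3.11's local road, p. 416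
«In [4] we have proved that the operator G_□(1) is positive») × N10 ROAD «C»; seat `pub-ymgap-dag-n06-j` g27 (bundle F5), filed `--supports stmt-QuantumFields-27364`
(count-neutral helper).  WHY THIS FILE: the (Rᴸ²⁴) letter of C6d (`lemma24_letter_twoLevel_sites`, dag-n10-c p660289) and its def-Y reading (`local_lemma24_real_twoLevel`,
p661314) carry LABEL MARGINS «one big block off the box boundary» (`hboxS`, `hboxT`), with the standing remark «wrapping cubes go through the torus charts» (the design of
record, `B6GlobalChartV1` HONEST SCOPE (3)).  Row 17's faces for EVERY enlarged cube `□̃(c)` (`Summits/…/BalabanUVNodesN06Row17LocalCentreEveryCube`, g26) therefore still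
display the margins, which FAIL for the cubes meeting the seam of the global chart.  THIS FILE is the chart step: the V1 translation covariance of r03's `B6TranslateV1`
(`IsTr`, `UB`, `dcE_UB`, `IsTr.QE_UB`, `IsTr.idxB`, `IsTr.lamBond_iff`, `blockOf_add_tv`, `iterBlockOf_add_tv`) transports C6d from a translated frame `D₂` (where the
margins hold) back to the frame `D₁` of the data; `B6TranslateTorusV1.isTr_domT_chart` («`domT (D.chart s)` IS the translate of `domT D` by `(M·L^k)·s`») gives the def-Y
reading with a chart vector `s`.  IMPORTS `B9LocalLemma24TwoLevelAtLettersY` (C6d + the def-Y wrapper's opens), `B6TranslateTorusV1`; nothing restated.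

THE PRINT (verbatim, p. 245): *«L^{d−2} Σ_{c∈Λ′} |(Q₁B)(c)|² + Σ_p |(∂₁B)(p)|² ≥ (1∕(12d²)) L^{−d−1} ‖B‖². (2.128)»*; p. 239 (2.89): *«We define B^j(Λ) = □̃ ∩ B^{j+1}(Λ_{j+1})»*;
p. 238: *«We identify the boundary of □̃³ and we get a torus which will be denoted by T_□»*.

WHAT IS PROVED (sorry-free; standard axioms; transport + label∕site bookkeeping [folklore] over C6d):
* §1 ★ `cornerV1_add_tv` (corners of translated blocks), ★ `runSum_trV`, `mixSite_add`, ★ `stairSum_trV` (`(τ_a A)(Γ_{y,x}) =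
  A(Γ_{y+a,x+a})` — staircase sums are translation covariant).
* §2 ★★ **`lemma24_letter_twoLevel_sites_of_isTr`** — C6d for data `D₁, S, T, w, B` with the margins of the TRANSLATED labels `y − v∕Lʲ`, `Y − v∕L^{j+1}` in a frame
  `D₂`, `IsTr D₁ D₂ v`: apply C6d at `D₂` to `S − v∕Lʲ`, `T − v∕L^{j+1}`, `w ∘ idxB`, `U_v B`; every hypothesis corresponds (`lamBond_iff`, `blockOf_add_tv`,
  `iterBlockOf_add_tv`, `stairSum_trV`, `cornerV1_add_tv`) and the three terms of the inequality are invariant (`U_v` isometry, `dcE_UB`, `QE_UB` + `Equiv.sum_comp`).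
* §3 ★★ **`local_lemma24_real_twoLevel_chart`** — the def-Y reading at an index `i : KIdx`: `B9LocalLemma24TwoLevelAtLettersY.local_lemma24_real_twoLevel` VERBATIM except
  that `hboxS`∕`hboxT` are asked of the labels `y − tv (tvec s) j`, `Y − tv (tvec s) (j+1)` of p21's chart `s : Fin (d+1) → ℤ` of the torus (`isTr_domT_chart`); `s = 0`
  recovers the original.
HONEST SCOPE.  Transport only; the estimate is C6b's kernel theorem through C6c∕C6d; which chart places a given cube off the seam is the consumer's geometry (this seat's
`B9LocalCubeGeometryChartY`); constants C6d's, level-dependent.  NOT a node discharge; count-neutral; one finite 𝕋⁴ programme — nothing continuum ∕ OS ∕ mass gap ∕ Clay.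
No `sorry`∕`axiom`∕`instance`∕`def`.
-/

open scoped InnerProductSpace

namespace Literature.MathematicalPhysics.QuantumFieldTheory.Balaban1983to89.B6SectALemma24TwoLevelV1SitesChart

open Finset
open Literature.MathematicalPhysics.QuantumFieldTheory.Balaban1983to89
open LatticeFieldCalculus B5Eq118OneStroke B5Eq120IterProof B6SectADomainsV1 B6SectAOperatorsV1 B6TranslateV1
open Literature.MathematicalPhysics.QuantumFieldTheory.BalabanImbrieJaffe1984to88.BIJ85AxialPropagator411 (BondSpace)
open Literature.MathematicalPhysics.QuantumFieldTheory.Balaban1983to89.B6SectALemma24OneLevelV1 (cornerV1 normSq_dcE_eq sitesPerDir_zero_eq_mul)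
open Literature.MathematicalPhysics.QuantumFieldTheory.Balaban1983to89.B6SectALemma24TwoLevelV1Sites (lemma24_letter_twoLevel_sites)
open Literature.MathematicalPhysics.QuantumFieldTheory.Balaban1983to89.B9LocalLemma24AtLettersY (curlK_mulVec_apply_eq)
open Literature.MathematicalPhysics.QuantumFieldTheory.Balaban1983to89.B6TranslateTorusV1 (isTr_domT_chart)

noncomputable section

variable {P : Params}

/-! ## §1. Translation bookkeeping: divisibility, corners of translated blocks, staircase sums -/

section Bookkeeping

variable {n : ℕ} {V : Type*} [AddCommGroup V]

/-- divisibility by a lower power of `L`. [folklore] -/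
private theorem dvd_pow_of_le {n n' : ℕ} (h : n ≤ n') {v : Fin P.d → ℤ} (hv : ∀ μ, ((P.L : ℤ) ^ n') ∣ v μ) (μ : Fin P.d) :
    ((P.L : ℤ) ^ n) ∣ v μ :=
  dvd_trans (pow_dvd_pow _ h) (hv μ)

/-- ★ **CORNERS OF TRANSLATED BLOCKS**: the corner of `Bⁿ(y + v∕Lⁿ)` is the corner of `Bⁿ(y)` translated by `v` (`Lⁿ ∣ v`, standing range `n ≤ m + K`).
[cite: Balaban1984PropagatorsI, (1.6)–(1.7) p.18; Balaban1984PropagatorsII, (2.1) p.224; folklore] -/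
theorem cornerV1_add_tv (hn : n ≤ P.m + P.K) {v : Fin P.d → ℤ} (hv : ∀ μ, ((P.L : ℤ) ^ n) ∣ v μ) (y : Site P n) :
    cornerV1 n (y + tv P v n) = cornerV1 n y + tv P v 0 := by
  funext μ
  obtain ⟨q, hq⟩ := hv μ
  have hL0 : ((P.L : ℤ) ^ n) ≠ 0 := pow_ne_zero _ (by exact_mod_cast P.L_pos.ne')
  have hN : P.sitesPerDir 0 = P.sitesPerDir n * P.L ^ n := sitesPerDir_zero_eq_mul hn
  -- the level-`n` coordinate of the translate, modulo `N_n`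
  have hmod : ((P.sitesPerDir n : ℕ) : ℤ) ∣ (((y μ + (q : ZMod (P.sitesPerDir n))).val : ℕ) : ℤ) - (((y μ).val : ℕ) : ℤ) - q := by
    have h : ((((y μ + (q : ZMod (P.sitesPerDir n))).val : ℕ) : ℤ) : ZMod (P.sitesPerDir n)) =
        (((((y μ).val : ℕ) : ℤ) + q : ℤ) : ZMod (P.sitesPerDir n)) := by
      push_cast; rw [ZMod.natCast_zmod_val, ZMod.natCast_zmod_val]
    have := (ZMod.intCast_eq_intCast_iff_dvd_sub _ _ _).1 h.symm
    simpa [sub_sub] using this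
  have h1 : (y + tv P v n) μ = y μ + (q : ZMod (P.sitesPerDir n)) := by
    rw [Site.add_apply, tv_apply, hq, Int.mul_ediv_cancel_left _ hL0]
  have h2 : (cornerV1 n y + tv P v 0) μ = cornerV1 n y μ + ((v μ : ℤ) : ZMod (P.sitesPerDir 0)) := by
    rw [Site.add_apply, tv_zero_apply]
  rw [h2]
  simp only [cornerV1]
  rw [h1, hq, ← Int.cast_add, ZMod.intCast_eq_intCast_iff_dvd_sub, hN]
  obtain ⟨c, hc⟩ := hmod
  refine ⟨-c, ?_⟩
  have hc' : (((y μ + (q : ZMod (P.sitesPerDir n))).val : ℕ) : ℤ) = (((y μ).val : ℕ) : ℤ) + q + (P.sitesPerDir n : ℤ) * c := by linarith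
  push_cast
  rw [hc']
  ring

/-- a backward step commutes with translation: `⟨update x μ (x_μ − s), μ⟩ + a = ⟨update (x + a) μ ((x + a)_μ − s), μ⟩`. [folklore] -/
private theorem translate_update_sub (x a : Site P n) (μ : Fin P.d) (s : ZMod (P.sitesPerDir n)) :
    (⟨Function.update x μ (x μ - s), μ⟩ : PBond P n).translate a = ⟨Function.update (x + a) μ ((x + a) μ - s), μ⟩ := by
  simp only [PBond.translate]
  congr 1
  funext ν
  rw [Site.add_apply]
  by_cases h : ν = μ
  · subst h; simp only [Function.update_self, Site.add_apply]; abel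
  · simp only [Function.update_of_ne h, Site.add_apply]

/-- ★ **SIGNED STRAIGHT RUNS ARE TRANSLATION COVARIANT**: `runSum (τ_a A) x μ n = runSum A (x + a) μ n` for every `n ∈ ℤ`.
[cite: Balaban1984PropagatorsI, (1.7)–(1.8) pp.18–19; folklore] -/
theorem runSum_trV (a : Site P n) (A : PBond P n → V) (x : Site P n) (μ : Fin P.d) :
    ∀ z : ℤ, runSum (trV a A) x μ z = runSum A (x + a) μ z
  | (t : ℕ) => by rw [runSum_ofNat, runSum_ofNat, segSum_trV]
  | Int.negSucc t => by
    simp only [runSum, trV_apply]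
    congr 1
    refine Finset.sum_congr rfl fun s _ => ?_
    congr 1
    exact translate_update_sub x a μ _

/-- the staircase corners translate: `mixSite μ (y + a) (x + a) = mixSite μ y x + a`. [cite: Balaban1984PropagatorsI, (1.7) p.18; folklore] -/
theorem mixSite_add (μ : Fin P.d) (y x a : Site P n) : mixSite μ (y + a) (x + a) = mixSite μ y x + a := by
  funext ν
  by_cases h : μ < ν
  · simp only [mixSite, h, if_true, Site.add_apply]
  · simp only [mixSite, h, if_false, Site.add_apply]

/-- ★ **STAIRCASE SUMS ARE TRANSLATION COVARIANT**: `(τ_a A)(Γ_{y,x}) = A(Γ_{y+a,x+a})`. [cite: Balaban1984PropagatorsI, (1.7) p.18, p.19 («by translation»); folklore] -/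
theorem stairSum_trV (a : Site P n) (A : PBond P n → V) (y x : Site P n) : stairSum (trV a A) y x = stairSum A (y + a) (x + a) := by
  unfold stairSum
  refine Finset.sum_congr rfl fun μ _ => ?_
  rw [runSum_trV, mixSite_add, Site.add_apply, Site.add_apply, add_sub_add_right_eq_sub]

end Bookkeeping

/-! ## §2. The two-scale Lemma-2.4 letter with the margins in a translated frame -/

section Transport

variable {j : ℕ}

/-- ★★ **THE LEMMA-2.4 LETTER OF C6d FOR A CUBE MEETING `Ω_{j+1}`, MARGINS IN A TRANSLATED FRAME.**  Data as in
`B6SectALemma24TwoLevelV1Sites.lemma24_letter_twoLevel_sites` for a nested family `D₁` (`S ⊆ T^{(j)}`, `T ⊆ T^{(j+1)}`, `blockOf y ∉ T` on `S`, the index facts `hIS`∕`hIB` in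
`D₁`'s `LamBond` language, weights `w ≥ w₀ ≥ 0` on `𝔅(D₁)`, a configuration `B` carried by the bonds meeting the blocks of `S`, `T` with vanishing corner staircase sums there),
EXCEPT that the label margins «one big block off the box boundary» are asked of the TRANSLATED labels `y − v∕Lʲ` (`y ∈ S`), `Y − v∕L^{j+1}` (`Y ∈ T`) for a frame `D₂` with
`IsTr D₁ D₂ v` (the cube read in a chart of the torus in which it does not meet the seam).  Then **`κ·‖B‖² ≤ ‖∂B‖² + Σ_{𝔅(D₁)} w·(QB)²`** with C6d's
`κ = (12d²(1 + 12d·L^{2j}))⁻¹·((L^{j+1})^{d+1})⁻¹·min(c²/2, w₀/(L^{j+1})^{d−2})` — C6d at `D₂` for `S − v∕Lʲ`, `T − v∕L^{j+1}`, `w ∘ idxB`, `U_v B`, transported back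
along the isometries `U_v` (bonds ∕ plaquettes) and the reindexing `idxB : 𝔅(D₂) ≃ 𝔅(D₁)`.
[cite: Balaban1984PropagatorsII, Lemma 2.4 (2.128) p.245, (2.89) p.239, p.238 (T_□), (2.1)–(2.4) p.224, (2.19)–(2.20) p.226, (2.121) p.244] -/
theorem lemma24_letter_twoLevel_sites_of_isTr (hd : 2 ≤ P.d) {D₁ D₂ : Domains P} {v : Fin P.d → ℤ} (h : IsTr D₁ D₂ v) (hjk : j + 1 ≤ D₁.k)
    (S : Finset (Site P j)) (T : Finset (Site P (j + 1)))
    (hST : ∀ y ∈ S, blockOf y ∉ T)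
    (hboxS : ∀ y ∈ S, ∀ i, P.L ^ (j + 1) ≤ ((y - tv P v j) i).val * P.L ^ j ∧
      ((y - tv P v j) i).val * P.L ^ j + P.L ^ j + P.L ^ (j + 1) ≤ P.sitesPerDir 0)
    (hboxT : ∀ Y ∈ T, ∀ i, P.L ^ (j + 1) ≤ ((Y - tv P v (j + 1)) i).val * P.L ^ (j + 1) ∧
      ((Y - tv P v (j + 1)) i).val * P.L ^ (j + 1) + 2 * P.L ^ (j + 1) ≤ P.sitesPerDir 0)
    (hIS : ∀ bb : PBond P j, (bb.src ∈ S ∨ bb.tgt ∈ S) → blockOf bb.src ∉ T → blockOf bb.tgt ∉ T → D₁.LamBond j bb)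
    (hIB : ∀ BB : PBond P (j + 1), (BB.src ∈ T ∨ BB.tgt ∈ T) → D₁.LamBond (j + 1) BB)
    (c : ℝ) {w : BondIdx D₁ → ℝ} {w₀ : ℝ} (hw₀ : 0 ≤ w₀) (hw : ∀ i, w₀ ≤ w i) (B : BondSpace P)
    (hoff : ∀ b : PBond P 0, WithLp.ofLp B b ≠ 0 →
      (∃ y ∈ S, b.src ∈ iterBlock j y ∨ b.tgt ∈ iterBlock j y) ∨ (∃ Y ∈ T, b.src ∈ iterBlock (j + 1) Y ∨ b.tgt ∈ iterBlock (j + 1) Y))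
    (hTs : ∀ y ∈ S, ∀ x ∈ iterBlock j y, stairSum (WithLp.ofLp B) (cornerV1 j y) x = 0)
    (hTb : ∀ Y ∈ T, ∀ x ∈ iterBlock (j + 1) Y, stairSum (WithLp.ofLp B) (cornerV1 (j + 1) Y) x = 0) :
    (12 * (P.d : ℝ) ^ 2 * (1 + 12 * (P.d : ℝ) * ((P.L : ℝ) ^ j) ^ 2))⁻¹ * (((P.L : ℝ) ^ (j + 1)) ^ (P.d + 1))⁻¹ *
        min (c ^ 2 / 2) (w₀ / ((P.L : ℝ) ^ (j + 1)) ^ (P.d - 2)) * ‖B‖ ^ 2 ≤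
      ‖dcE c B‖ ^ 2 + ∑ i, w i * QE D₁ B i ^ 2 := by
  classical
  -- ranges and divisibilities
  have hjm : j + 1 ≤ P.m + P.K := le_trans hjk D₁.hk
  have hjm0 : j ≤ P.m + P.K := le_trans (Nat.le_succ j) hjm
  have hvj : ∀ μ, ((P.L : ℤ) ^ j) ∣ v μ := dvd_pow_of_le (le_trans (Nat.le_succ j) hjk) h.dvd
  have hvj1 : ∀ μ, ((P.L : ℤ) ^ (j + 1)) ∣ v μ := dvd_pow_of_le hjk h.dvd
  -- notation: the translation vectors at the three levels
  set a : Site P 0 := tv P v 0 with ha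
  set tj : Site P j := tv P v j with htj
  set tJ : Site P (j + 1) := tv P v (j + 1) with htJ
  -- the translated data
  set S₂ : Finset (Site P j) := S.map (Equiv.addRight tj).symm.toEmbedding with hS₂def
  set T₂ : Finset (Site P (j + 1)) := T.map (Equiv.addRight tJ).symm.toEmbedding with hT₂def
  have hS₂ : ∀ {y}, y ∈ S₂ ↔ y + tj ∈ S := fun {y} => by
    rw [hS₂def, Finset.mem_map_equiv, Equiv.symm_symm, Equiv.coe_addRight]
  have hT₂ : ∀ {Y}, Y ∈ T₂ ↔ Y + tJ ∈ T := fun {Y} => by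
    rw [hT₂def, Finset.mem_map_equiv, Equiv.symm_symm, Equiv.coe_addRight]
  -- blocks go to blocks
  have hblk : ∀ y : Site P j, blockOf (y + tj) = blockOf y + tJ := fun y => blockOf_add_tv hjm hvj1 y
  have hitb : ∀ x : Site P 0, iterBlockOf j (x + a) = iterBlockOf j x + tj := fun x => iterBlockOf_add_tv j hjm0 hvj x
  have hitB : ∀ x : Site P 0, iterBlockOf (j + 1) (x + a) = iterBlockOf (j + 1) x + tJ := fun x => iterBlockOf_add_tv (j + 1) hjm hvj1 x
  set B₂ : BondSpace P := UB a B with hB₂def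
  have hB₂ : ∀ b : PBond P 0, WithLp.ofLp B₂ b = WithLp.ofLp B (b.translate a) := fun b => rfl
  -- C6d in the frame `D₂`
  have key := lemma24_letter_twoLevel_sites hd D₂ (by rw [h.k_eq]; exact hjk) S₂ T₂
    (fun y hy hyT => hST _ (hS₂.1 hy) (by rw [hblk]; exact hT₂.1 hyT))
    (fun y hy i => by simpa only [add_sub_cancel_right] using hboxS _ (hS₂.1 hy) i)
    (fun Y hY i => by simpa only [add_sub_cancel_right] using hboxT _ (hT₂.1 hY) i)
    (fun bb hbS hs ht => by
      rw [h.lamBond_iff]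
      refine hIS (bb.translate tj) ?_ ?_ ?_
      · rcases hbS with hb | hb
        · exact Or.inl (by rw [PBond.translate_src]; exact hS₂.1 hb)
        · exact Or.inr (by rw [translate_tgt]; exact hS₂.1 hb)
      · rw [PBond.translate_src, hblk]; exact fun hh => hs (hT₂.2 hh)
      · rw [translate_tgt, hblk]; exact fun hh => ht (hT₂.2 hh))
    (fun BB hBT => by
      rw [h.lamBond_iff]
      refine hIB (BB.translate tJ) ?_
      rcases hBT with hb | hb
      · exact Or.inl (by rw [PBond.translate_src]; exact hT₂.1 hb)
      · exact Or.inr (by rw [translate_tgt]; exact hT₂.1 hb))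
    c (w := w ∘ h.idxB) hw₀ (fun i => hw _) B₂
    (fun b hb => by
      rw [hB₂] at hb
      rcases hoff _ hb with ⟨y, hy, hmem⟩ | ⟨Y, hY, hmem⟩
      · refine Or.inl ⟨y - tj, hS₂.2 (by rw [sub_add_cancel]; exact hy), ?_⟩
        simp only [mem_iterBlock, PBond.translate_src, translate_tgt, hitb] at hmem ⊢
        rcases hmem with hm | hm
        · exact Or.inl (by rw [← hm, add_sub_cancel_right])
        · exact Or.inr (by rw [← hm, add_sub_cancel_right])
      · refine Or.inr ⟨Y - tJ, hT₂.2 (by rw [sub_add_cancel]; exact hY), ?_⟩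
        simp only [mem_iterBlock, PBond.translate_src, translate_tgt, hitB] at hmem ⊢
        rcases hmem with hm | hm
        · exact Or.inl (by rw [← hm, add_sub_cancel_right])
        · exact Or.inr (by rw [← hm, add_sub_cancel_right]))
    (fun y hy x hx => by
      rw [ofLp_UB, stairSum_trV, ← cornerV1_add_tv hjm0 hvj]
      refine hTs _ (hS₂.1 hy) _ ?_
      rw [mem_iterBlock] at hx ⊢
      rw [hitb, hx])
    (fun Y hY x hx => by
      rw [ofLp_UB, stairSum_trV, ← cornerV1_add_tv hjm hvj1]
      refine hTb _ (hT₂.1 hY) _ ?_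
      rw [mem_iterBlock] at hx ⊢
      rw [hitB, hx])
  -- transport of the three terms back to the frame `D₁`
  have hn : ‖B₂‖ = ‖B‖ := (UB a).norm_map B
  have hc : ‖dcE c B₂‖ = ‖dcE c B‖ := by rw [hB₂def, ha, dcE_UB]; exact (UP _).norm_map _
  have hQ : ∑ i, (w ∘ h.idxB) i * QE D₂ B₂ i ^ 2 = ∑ i, w i * QE D₁ B i ^ 2 := by
    rw [hB₂def, ha, h.QE_UB]
    simp only [Function.comp_apply, IsTr.UI_apply]
    exact h.idxB.sum_comp (fun i => w i * QE D₁ B i ^ 2)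
  rw [hn, hc, hQ] at key
  exact key

end Transport

/-! ## §3. The def-Y reading: the two-level local Lemma-2.4 letter at def-Y's box through p21's chart `s` of the torus -/

section DefY

open Node00 B6KLevelCensusIndexV1 B6GlobalChartV1 B6MultiLevelTorusOperator
open scoped Matrix

variable {d ℓ : ℕ} {hd : 1 ≤ d + 1} {hL : Odd (ℓ + 1) ∧ 1 < ℓ + 1} {b₀ b₁ : ℝ} (i : KIdx d ℓ hd hL b₀ b₁)

/-- ★★ **THE LOCAL LEMMA-2.4 LETTER (Rᴸ²⁴) AT def-Y's BOX FOR A CUBE MEETING `Ω_{j+1}`, THROUGH THE CHART `s` OF THE TORUS** — dag-n10-c's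
`B9LocalLemma24TwoLevelAtLettersY.local_lemma24_real_twoLevel` VERBATIM (block sets `S`, `T`, `blockOf y ∉ T`, index facts `hIS`∕`hIB`, weights `≥ w₀ > 0`, a real bond
field `v` carried by the bonds meeting the blocks with vanishing corner staircase sums), EXCEPT that the label margins «one big block off the box boundary» are asked of the
TRANSLATED labels `y − tv (tvec s) j` (`y ∈ S`), `Y − tv (tvec s) (j+1)` (`Y ∈ T`) of p21's torus chart `s` (translation by `(M·L^k)·s`; `s = 0` is the original): the cube
may wrap around the seam of the global chart.  Conclusion unchanged: **`κ·Σ_b v(b)² ≤ Σ_p ((curlK·v)(p))² + Σ_ι w(ι)·((qK·v)(ι))²`,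
`κ = (12(d+1)²(1 + 12(d+1)·L^{2j}))⁻¹·((L^{j+1})^{d+2})⁻¹·min(c_f²∕2, w₀∕(L^{j+1})^{d−1})`** — §2 at `IsTr (domT D) (domT (D.chart s)) ((M·L^k)·s)`
(`B6TranslateTorusV1.isTr_domT_chart`). [cite: Balaban1984PropagatorsII, Lemma 2.4 (2.128) p.245, (2.89) p.239, p.238 (T_□), (2.121) p.244, (2.18)–(2.20) p.226, (2.1)–(2.3) p.224; Balaban1984PropagatorsI, (1.18) p.20] -/
theorem local_lemma24_real_twoLevel_chart (hd2 : 2 ≤ d + 1) {j : ℕ} (hjk : j + 1 ≤ (domT i.hN i.D i.hk).k) (s : Fin (d + 1) → ℤ)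
    (S : Finset (Site (PV d ℓ i.m i.K hd hL) j)) (T : Finset (Site (PV d ℓ i.m i.K hd hL) (j + 1)))
    (hST : ∀ y ∈ S, blockOf y ∉ T)
    (hboxS : ∀ y ∈ S, ∀ μ, (ℓ + 1) ^ (j + 1) ≤ ((y - tv (PV d ℓ i.m i.K hd hL) (TDomains.tvec ℓ i.Mh i.k s) j) μ).val * (ℓ + 1) ^ j ∧
      ((y - tv (PV d ℓ i.m i.K hd hL) (TDomains.tvec ℓ i.Mh i.k s) j) μ).val * (ℓ + 1) ^ j + (ℓ + 1) ^ j + (ℓ + 1) ^ (j + 1) ≤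
        (PV d ℓ i.m i.K hd hL).sitesPerDir 0)
    (hboxT : ∀ Y ∈ T, ∀ μ, (ℓ + 1) ^ (j + 1) ≤ ((Y - tv (PV d ℓ i.m i.K hd hL) (TDomains.tvec ℓ i.Mh i.k s) (j + 1)) μ).val * (ℓ + 1) ^ (j + 1) ∧
      ((Y - tv (PV d ℓ i.m i.K hd hL) (TDomains.tvec ℓ i.Mh i.k s) (j + 1)) μ).val * (ℓ + 1) ^ (j + 1) + 2 * (ℓ + 1) ^ (j + 1) ≤
        (PV d ℓ i.m i.K hd hL).sitesPerDir 0)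
    (hIS : ∀ bb : PBond (PV d ℓ i.m i.K hd hL) j, (bb.src ∈ S ∨ bb.tgt ∈ S) → blockOf bb.src ∉ T → blockOf bb.tgt ∉ T →
      (domT i.hN i.D i.hk).LamBond j bb)
    (hIB : ∀ BB : PBond (PV d ℓ i.m i.K hd hL) (j + 1), (BB.src ∈ T ∨ BB.tgt ∈ T) → (domT i.hN i.D i.hk).LamBond (j + 1) BB)
    {w₀ : ℝ} (hw₀ : 0 < w₀) (hw : ∀ ι : IBondY i, w₀ ≤ i.w ι) (v : FBondY i → ℝ)
    (hoff : ∀ b : FBondY i, v b ≠ 0 →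
      (∃ y ∈ S, b.src ∈ iterBlock j y ∨ b.tgt ∈ iterBlock j y) ∨ (∃ Y ∈ T, b.src ∈ iterBlock (j + 1) Y ∨ b.tgt ∈ iterBlock (j + 1) Y))
    (hTs : ∀ y ∈ S, ∀ x ∈ iterBlock j y, stairSum v (cornerV1 j y) x = 0)
    (hTb : ∀ Y ∈ T, ∀ x ∈ iterBlock (j + 1) Y, stairSum v (cornerV1 (j + 1) Y) x = 0) :
    (12 * (((d + 1 : ℕ) : ℝ)) ^ 2 * (1 + 12 * (((d + 1 : ℕ) : ℝ)) * ((((ℓ + 1 : ℕ) : ℝ)) ^ j) ^ 2))⁻¹ *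
          (((((ℓ + 1 : ℕ) : ℝ)) ^ (j + 1)) ^ (d + 1 + 1))⁻¹ * min (i.cf ^ 2 / 2) (w₀ / ((((ℓ + 1 : ℕ) : ℝ)) ^ (j + 1)) ^ (d + 1 - 2)) *
        ∑ b, v b ^ 2 ≤
      ∑ p, (curlK i *ᵥ v) p ^ 2 + ∑ ι, i.w ι * (qK i *ᵥ v) ι ^ 2 := by
  classical
  have h := lemma24_letter_twoLevel_sites_of_isTr (P := PV d ℓ i.m i.K hd hL) hd2 (isTr_domT_chart i.hN i.D i.hk s) hjk S T hST hboxS hboxT hIS hIB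
    i.cf hw₀.le hw (WithLp.toLp 2 v) (fun b hb => hoff b (by rwa [WithLp.ofLp_toLp] at hb))
    (fun y hy x hx => by rw [WithLp.ofLp_toLp]; exact hTs y hy x hx) (fun Y hY x hx => by rw [WithLp.ofLp_toLp]; exact hTb Y hY x hx)
  rw [normSq_dcE_eq, WithLp.ofLp_toLp, EuclideanSpace.real_norm_sq_eq] at h
  -- the curl term and the averaging term at def-Y's kernels
  have hcurl : ∑ p, (curlK i *ᵥ v) p ^ 2 = i.cf ^ 2 * ∑ p : Plaq (PV d ℓ i.m i.K hd hL) 0, LatticeFieldCalculus.curl 1 v p ^ 2 := by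
    rw [Finset.mul_sum]
    exact Finset.sum_congr rfl fun p _ => by rw [curlK_mulVec_apply_eq]; ring
  have hQ : ∑ ι, i.w ι * (qK i *ᵥ v) ι ^ 2 = ∑ ι, i.w ι * QE (domT i.hN i.D i.hk) (WithLp.toLp 2 v) ι ^ 2 :=
    Finset.sum_congr rfl fun ι _ => by rw [qK_mulVec, QE_apply, WithLp.ofLp_toLp]
  rw [hcurl, hQ]
  simpa only [WithLp.ofLp_toLp] using h

end DefY

end

end Literature.MathematicalPhysics.QuantumFieldTheory.Balaban1983to89.B6SectALemma24TwoLevelV1SitesChart
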